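import Literature.MathematicalPhysics.QuantumFieldTheory.Balaban1983to89.Node00.Record13CarriersXPinnedHS
import Literature.MathematicalPhysics.QuantumFieldTheory.Balaban1983to89.Node00.Record13CarriersB8SubBHCoP

/-!
# NODE 00 (YM-PLAN Track A) — [III]'s END STATEMENT (B) FROM THE NODES AT THE S-BOUND v1.5 RECORDS: `endStatementBPrinted_of_isRecordOfRecord₁₃CSepCoPSX3H_of_nodes` and
# `endStatementBPrinted_of_isRecordOfRecord₁₃CSepCoPSB8subBH_of_nodes` — def-T's `endStatementBPrinted_of_isRecordOfRecord₁₃CSepCoP_of_nodes` (FILE 24T) RE-RUN at the two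
# S-bound records of this seat (`Record13CarriersXPinnedHS` p526966, `Record13CarriersB8SubBHCoP` p523976), through their C-bound companions

NODE 00 RECORD MODULE (seat `pub-ymgap-dag-n05-d` g6, 2026-08-27; APPEND-ONLY new module, everything BY NAME).  WHY (this seat's LOCATED-K1V3-B8, 11:31Z): the K1⁵
skeleton's rung binds its world by the C-bound record `IsRecordOfRecord₁₃CSepCoP`, at which N05's leaf is the TYPED Theorem-8 form no knit serves; the S-bound records carry
N05's SURVIVING leaf (served by `BalabanUVNodesN05SubBHKnitUnivT8Srv` modulo its displayed hypotheses).  For the rung to be statable over an S-bound record, the composition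
`nodes at the record's world ⇒ (B) printed at the datum` must exist there exactly as def-T proves it at the C-bound record.  It does, by the same three steps: (B) is a WORLD-level
consequence (`Record5.endStatementBPrinted_of_nodesP_interval_guarded`: nodes at every run + the (0.20) guard `smallCouplings → rgFlow` + the β bounds along runs in the window), the
guard is a LEAF other than `b8`, hence equal to the C-bound companion's (`companion_of_…`: `leavesP w P = { leavesP w′ P with b8 := … }`), where def-T's
`rgFlow_of_smallCouplings_of_isRecordOfRecord₁₃CSepCoP` supplies it, and `w.C = D.C` is a clause of the record.
WHAT IS PROVED: `rgFlow_of_smallCouplings_of_isRecordOfRecord₁₃CSepCoPSX3H`, ★ `endStatementBPrinted_of_isRecordOfRecord₁₃CSepCoPSX3H_of_nodes`; `rgFlow_of_smallCouplings_of_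
isRecordOfRecord₁₃CSepCoPSB8subBH`, ★ `endStatementBPrinted_of_isRecordOfRecord₁₃CSepCoPSB8subBH_of_nodes` — signatures = def-T's with the record predicate swapped.  So a v4 rung
«∃ θ h w (+ pins), … ∧ IsRecordOfRecord₁₃CSepCoPSX3H F 2 (datumOfRecord₁₃SepCoP θ h) w ∧ (∀ P, Nodes (leavesP w P)) ∧ …» composes to K1⁵'s consequent by THIS lemma in place of
def-T's, token for token (the plan's word, not asserted here).
HONEST FRAMING: kernel bookkeeping by name; NO estimate; nothing of Bałaban's asserted; (B) is derived only from the HYPOTHESIS «all nodes at every run» + the β bounds — no node is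
discharged; N05 NOT discharged; K1 NOT claimed; counts unmoved; one finite T⁴ programme at fixed ε — NOT continuum ∕ ℝ⁴ ∕ OS ∕ mass gap ∕ Clay.  No `sorry`, no definition.
[cite: Balaban1988Convergent, Thm 2 + (2.45)–(2.50) pp.262–263 (end statement (B)); Balaban1989LargeFieldII, Thm 1 + (0.1) pp.355–356; Balaban1987RG1, (0.20) p.256, (1.20)–(1.22) p.264 (bookkeeping)]
-/

noncomputable section

namespace Literature.MathematicalPhysics.QuantumFieldTheory.Balaban1983to89.Node00

open T4Continuum AveragingRT T4FiniteEpsInhabited FlowStep FlowStepRuns DagBinding T4DatumAssembly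
open scoped Matrix.Norms.L2Operator

variable {F : T4Family} {N : ℕ} [NeZero N] {D : FiniteEpsData F (SU N)} {w : WorldP}

/-- GUARDED (0.20) at every run of an S-bound X-pinned v1.5 record: the `smallCouplings ∕ rgFlow` leaves are the C-bound companion's (leaves equal off `b8`), where def-T's
`rgFlow_of_smallCouplings_of_isRecordOfRecord₁₃CSepCoP` supplies the implication. [cite: Balaban1987RG1, (0.20) p.256 (bookkeeping)] -/
theorem rgFlow_of_smallCouplings_of_isRecordOfRecord₁₃CSepCoPSX3H (h : IsRecordOfRecord₁₃CSepCoPSX3H F N D w) (P : B12.RunParams)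
    (hsc : (leavesP w P).smallCouplings) : (leavesP w P).rgFlow := by
  obtain ⟨w', hw', -, -, -, hleaves, -⟩ := companion_of_isRecordOfRecord₁₃CSepCoPSX3H h
  have h' := rgFlow_of_smallCouplings_of_isRecordOfRecord₁₃CSepCoP hw' P
  rw [hleaves P] at hsc ⊢
  exact h' hsc

/-- ★ **[III]'s END STATEMENT (B) AT THE DATUM OF AN S-BOUND X-PINNED v1.5 RECORD FROM THE NODES AT ITS WORLD** (def-T's `endStatementBPrinted_of_isRecordOfRecord₁₃CSepCoP_of_nodes`
with the record predicate swapped; same hypotheses: nodes at every run, the window bound `w.γ ≤ γ₀`, the β bounds in the interval).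
[cite: Balaban1988Convergent, Thm 2 + (2.45)–(2.50) pp.262–263; Balaban1989LargeFieldII, Thm 1 p.355 (bookkeeping)] -/
theorem endStatementBPrinted_of_isRecordOfRecord₁₃CSepCoPSX3H_of_nodes (h : IsRecordOfRecord₁₃CSepCoPSX3H F N D w) {γ₀ : ℝ} (hγ₀ : w.γ ≤ γ₀)
    (hnodes : ∀ P, Nodes (leavesP w P)) (hβ : BetaBoundsInInterval w.C.toB12 γ₀ w.b w.βup) :
    B16.EndStatementBPrinted D.C := by
  have hrg := rgFlow_of_smallCouplings_of_isRecordOfRecord₁₃CSepCoPSX3H h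
  obtain ⟨θ, hP, lam8, lam12, lam13, -, -, hC, hγ, -, -⟩ := h
  rw [← hC]
  exact endStatementBPrinted_of_nodesP_interval_guarded w hγ.1 hγ₀ hnodes hrg hβ

/-- GUARDED (0.20) at every run of a one-pin S-bound [B8″H] v1.5 record (same argument through `companion_of_isRecordOfRecord₁₃CSepCoPSB8subBH`).
[cite: Balaban1987RG1, (0.20) p.256 (bookkeeping)] -/
theorem rgFlow_of_smallCouplings_of_isRecordOfRecord₁₃CSepCoPSB8subBH (h : IsRecordOfRecord₁₃CSepCoPSB8subBH F N D w) (P : B12.RunParams)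
    (hsc : (leavesP w P).smallCouplings) : (leavesP w P).rgFlow := by
  obtain ⟨w', hw', -, -, -, hleaves, -⟩ := companion_of_isRecordOfRecord₁₃CSepCoPSB8subBH h
  have h' := rgFlow_of_smallCouplings_of_isRecordOfRecord₁₃CSepCoP hw' P
  rw [hleaves P] at hsc ⊢
  exact h' hsc

/-- ★ **[III]'s END STATEMENT (B) AT THE DATUM OF A ONE-PIN S-BOUND [B8″H] v1.5 RECORD FROM THE NODES AT ITS WORLD** (def-T's lemma with the record predicate swapped).
[cite: Balaban1988Convergent, Thm 2 + (2.45)–(2.50) pp.262–263; Balaban1989LargeFieldII, Thm 1 p.355 (bookkeeping)] -/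
theorem endStatementBPrinted_of_isRecordOfRecord₁₃CSepCoPSB8subBH_of_nodes (h : IsRecordOfRecord₁₃CSepCoPSB8subBH F N D w) {γ₀ : ℝ} (hγ₀ : w.γ ≤ γ₀)
    (hnodes : ∀ P, Nodes (leavesP w P)) (hβ : BetaBoundsInInterval w.C.toB12 γ₀ w.b w.βup) :
    B16.EndStatementBPrinted D.C := by
  have hrg := rgFlow_of_smallCouplings_of_isRecordOfRecord₁₃CSepCoPSB8subBH h
  obtain ⟨θ, hP, lam, -, -, hC, hγ, -, -⟩ := h
  rw [← hC]
  exact endStatementBPrinted_of_nodesP_interval_guarded w hγ.1 hγ₀ hnodes hrg hβ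

#print axioms endStatementBPrinted_of_isRecordOfRecord₁₃CSepCoPSX3H_of_nodes
#print axioms endStatementBPrinted_of_isRecordOfRecord₁₃CSepCoPSB8subBH_of_nodes

end Literature.MathematicalPhysics.QuantumFieldTheory.Balaban1983to89.Node00

end
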